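import Mathlib
import Literature.NumberTheory.Automorphic.HilbertModularFormQExpansion
import Summits.Langlands.Langlands.Theorems.CapacityClassicalityHilbertIntegralOverconvergentIsCongruenceEngineFamilyAxioms
import Summits.Langlands.Langlands.Theorems.CapacityClassicalityHilbertIntegralOverconvergentIsCongruenceStubSummableOfLevelGrowth
import Summits.Langlands.Langlands.Theorems.CapacityClassicalityHilbertIntegralOverconvergentIsCongruenceStubQIndexEncodingTrace
import Summits.Langlands.Langlands.Theorems.CapacityClassicalityHilbertIntegralOverconvergentIsCongruenceStubTotalDegreeLevelCount
import Summits.Langlands.Langlands.Theorems.CapacityClassicalityHilbertIntegralOverconvergentIsCongruenceStubCoeffRadiusFromTube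

/-!
# The engine-instance data: the graded family with the TRACE FORMULA of the encoding, and the archimedean hypothesis `harch`
# from convergence on the whole tube (section R endpoints)

Endpoints of RESHAPE 14 (section R) of line Sketch-ideate-r1-k1 for the crux `HilbertIntegralOverconvergentIsCongruence`
(stmt-Langlands-8485):

* `traceEngineFamily` — § Q's `engineFamilyAxioms` for an encoding `idx` with `∑_j idx ν j = Tr(αν)` on the cone, `α ∈ 𝓞 F`
  totally positive (`stub_qIndex_encoding_trace`): with the engine's weight `wt :=` total degree, the Sturm window `{wt < L}` IS the
  trace window `{Tr(αν) < L}` of the crux NOTES' named fact (i).  (The dictionary and the `q`-expansion principle are re-run for this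
  `idx`: `eid_dict_of_idx`, `eid_qexpRing_of_dict` are their encoding-parametric forms.)
* `archFromTube` — for `c : F → E` whose `q`-series converges absolutely on the whole tube under every complex embedding (the crux's
  archimedean hypothesis) and `G` encoding `c`, the weighted sizes `∑_n |τ(G_n)| e^{-η|n|}` are finite and bounded uniformly in `τ`
  (`stub_coeff_radius_from_tube`, `stub_totalDegree_levelCount`, the landed S17 `stub_summable_of_levelGrowth`) — the engine's
  `harch` for the unknown.
-/

set_option linter.dupNamespace false

noncomputable section

namespace Summit.Langlands.Langlands.Theorems.HilbertIntegralOverconvergentIsCongruence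

open MeasureTheory Complex NumberField
open Literature.NumberTheory.Automorphic Literature.NumberTheory.Automorphic.HilbertModular
open scoped MatrixGroups

/-- **The dictionary for a GIVEN encoding** (parametric form): O1, O2, O4 along any `idx` injective and additive on the cone. -/
theorem eid_dict_of_idx (F : Type) [Field F] [NumberField F] [NumberField.IsTotallyReal F] (d : ℕ) (idx : F → (Fin d →₀ ℕ))
    (hinj : Set.InjOn idx (qIndexSet F)) (hadd : ∀ μ ∈ qIndexSet F, ∀ μ' ∈ qIndexSet F, idx (μ + μ') = idx μ + idx μ') :
    ∀ (f g : Point F → ℂ), IsHolomorphicOn F f → IsHolomorphicOn F g →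
      (∀ (a : 𝓞 F) (z : Point F), z ∈ halfSpace F → f (fun σ ↦ z σ + ((σ (a : F) : ℝ) : ℂ)) = f z) →
      (∀ (a : 𝓞 F) (z : Point F), z ∈ halfSpace F → g (fun σ ↦ z σ + ((σ (a : F) : ℝ) : ℂ)) = g z) →
      (∀ μ : F, (∀ a : 𝓞 F, ∃ n : ℤ, Algebra.trace ℚ F (μ * a) = n) → μ ∉ qIndexSet F → fourierCoeff f μ = 0) →
      (∀ μ : F, (∀ a : 𝓞 F, ∃ n : ℤ, Algebra.trace ℚ F (μ * a) = n) → μ ∉ qIndexSet F → fourierCoeff g μ = 0) →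
      ∀ (A B P : MvPowerSeries (Fin d) ℂ), ((∀ μ ∈ qIndexSet F, MvPowerSeries.coeff (idx μ) A = fourierCoeff f μ) ∧
          ∀ n, (∀ μ ∈ qIndexSet F, idx μ ≠ n) → MvPowerSeries.coeff n A = 0) → ((∀ μ ∈ qIndexSet F, MvPowerSeries.coeff (idx μ) B = fourierCoeff g μ) ∧
          ∀ n, (∀ μ ∈ qIndexSet F, idx μ ≠ n) → MvPowerSeries.coeff n B = 0) →
        ((∀ μ ∈ qIndexSet F, MvPowerSeries.coeff (idx μ) P = fourierCoeff (f * g) μ) ∧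
          ∀ n, (∀ μ ∈ qIndexSet F, idx μ ≠ n) → MvPowerSeries.coeff n P = 0) → P = A * B := by
  intro f g hf hg hperf hperg hsf hsg A B P hA hB hP
  obtain ⟨hmul, hzero⟩ := stub_encoded_mul F idx hinj hadd ℂ (fourierCoeff f) (fourierCoeff g) A B hA.1 hA.2 hB.1 hB.2
  ext n
  by_cases hn : ∃ ν ∈ qIndexSet F, idx ν = n
  · obtain ⟨ν, hν, rfl⟩ := hn
    set T : Finset (F × F) := (stub_finite_qIndex_antidiagonal F ν).toFinset with hTdef
    have hT : ∀ μ : F × F, μ ∈ T ↔ μ.1 ∈ qIndexSet F ∧ μ.2 ∈ qIndexSet F ∧ μ.1 + μ.2 = ν := fun μ ↦ by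
      rw [hTdef, Set.Finite.mem_toFinset]; rfl
    rw [hP.1 ν hν, hmul ν hν T hT]
    exact stub_fourierCoeff_mul F f g hf hg hperf hperg hsf hsg ν hν.1 T hT
  · push Not at hn
    rw [hP.2 n hn, hzero n hn]

/-- **The `q`-expansion principle for a GIVEN encoding** (parametric form of the composition below): any encoding `idx` of the
cone, injective and additive there, along which the multiplicative dictionary holds, carries the graded-algebra embedding `enc`. -/
theorem eid_qexpRing_of_dict (F : Type) [Field F] [NumberField F] [NumberField.IsTotallyReal F] (hd : 1 < Module.finrank ℚ F) (𝔫 : Ideal (𝓞 F))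
    (h𝔫 : 𝔫 ≠ ⊥) (d : ℕ) (idx : F → (Fin d →₀ ℕ)) (hinj : Set.InjOn idx (qIndexSet F))
    (hadd : ∀ μ ∈ qIndexSet F, ∀ μ' ∈ qIndexSet F, idx (μ + μ') = idx μ + idx μ')
    (hdict : ∀ (f g : Point F → ℂ), IsHolomorphicOn F f → IsHolomorphicOn F g →
      (∀ (a : 𝓞 F) (z : Point F), z ∈ halfSpace F → f (fun σ ↦ z σ + ((σ (a : F) : ℝ) : ℂ)) = f z) →
      (∀ (a : 𝓞 F) (z : Point F), z ∈ halfSpace F → g (fun σ ↦ z σ + ((σ (a : F) : ℝ) : ℂ)) = g z) →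
      (∀ μ : F, (∀ a : 𝓞 F, ∃ n : ℤ, Algebra.trace ℚ F (μ * a) = n) → μ ∉ qIndexSet F → fourierCoeff f μ = 0) →
      (∀ μ : F, (∀ a : 𝓞 F, ∃ n : ℤ, Algebra.trace ℚ F (μ * a) = n) → μ ∉ qIndexSet F → fourierCoeff g μ = 0) →
      ∀ (A B P : MvPowerSeries (Fin d) ℂ), ((∀ μ ∈ qIndexSet F, MvPowerSeries.coeff (idx μ) A = fourierCoeff f μ) ∧
          ∀ n, (∀ μ ∈ qIndexSet F, idx μ ≠ n) → MvPowerSeries.coeff n A = 0) → ((∀ μ ∈ qIndexSet F, MvPowerSeries.coeff (idx μ) B = fourierCoeff g μ) ∧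
          ∀ n, (∀ μ ∈ qIndexSet F, idx μ ≠ n) → MvPowerSeries.coeff n B = 0) →
        ((∀ μ ∈ qIndexSet F, MvPowerSeries.coeff (idx μ) P = fourierCoeff (f * g) μ) ∧
          ∀ n, (∀ μ ∈ qIndexSet F, idx μ ≠ n) → MvPowerSeries.coeff n P = 0) → P = A * B) :
    ∃ (enc : (Point F → ℂ) → MvPowerSeries (Fin d) ℂ),
      (∀ f : Point F → ℂ, (∀ μ ∈ qIndexSet F, MvPowerSeries.coeff (idx μ) (enc f) = fourierCoeff f μ) ∧
          ∀ n, (∀ μ ∈ qIndexSet F, idx μ ≠ n) → MvPowerSeries.coeff n (enc f) = 0) ∧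
      (∀ (k k' : (F →+* ℝ) → ℤ) (f g : Point F → ℂ), f ∈ modularForms (Bianchi.Gamma1 𝔫) k →
          g ∈ modularForms (Bianchi.Gamma1 𝔫) k' → enc (f * g) = enc f * enc g) ∧
      (∀ (k : (F →+* ℝ) → ℤ) (f g : Point F → ℂ), f ∈ modularForms (Bianchi.Gamma1 𝔫) k →
          g ∈ modularForms (Bianchi.Gamma1 𝔫) k → enc (f + g) = enc f + enc g) ∧
      (∀ (k : (F →+* ℝ) → ℤ) (c : ℂ) (f : Point F → ℂ), f ∈ modularForms (Bianchi.Gamma1 𝔫) k →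
          enc (c • f) = c • enc f) ∧
      ((halfSpace F).indicator (fun _ ↦ (1 : ℂ)) ∈ modularForms (Bianchi.Gamma1 𝔫) 0 ∧
          enc ((halfSpace F).indicator (fun _ ↦ (1 : ℂ))) = 1) ∧
      ∀ (k k' : (F →+* ℝ) → ℤ) (f g : Point F → ℂ), f ∈ modularForms (Bianchi.Gamma1 𝔫) k →
          g ∈ modularForms (Bianchi.Gamma1 𝔫) k' → enc f = enc g → f = g := by
  classical
  -- the encoding of a coefficient function
  let enc : (Point F → ℂ) → MvPowerSeries (Fin d) ℂ := fun f n ↦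
    if h : ∃ μ ∈ qIndexSet F, idx μ = n then fourierCoeff f h.choose else 0
  have enc_coeff : ∀ (f : Point F → ℂ) (n : Fin d →₀ ℕ), MvPowerSeries.coeff n (enc f) =
      if h : ∃ μ ∈ qIndexSet F, idx μ = n then fourierCoeff f h.choose else 0 := fun _ _ ↦ rfl
  have henc : ∀ f : Point F → ℂ, (∀ μ ∈ qIndexSet F, MvPowerSeries.coeff (idx μ) (enc f) = fourierCoeff f μ) ∧
      ∀ n, (∀ μ ∈ qIndexSet F, idx μ ≠ n) → MvPowerSeries.coeff n (enc f) = 0 := by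
    intro f
    refine ⟨fun μ hμ ↦ ?_, fun n hn ↦ ?_⟩
    · have hex : ∃ μ' ∈ qIndexSet F, idx μ' = idx μ := ⟨μ, hμ, rfl⟩
      rw [enc_coeff, dif_pos hex]
      congr 1
      exact hinj hex.choose_spec.1 hμ hex.choose_spec.2
    · have hex : ¬ ∃ μ' ∈ qIndexSet F, idx μ' = n := fun ⟨μ', hμ', h⟩ ↦ hn μ' hμ' h
      rw [enc_coeff, dif_neg hex]
  -- coefficientwise description of `enc` from linear data on the cone
  have enc_ext : ∀ (f : Point F → ℂ) (Q : MvPowerSeries (Fin d) ℂ),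
      (∀ μ ∈ qIndexSet F, MvPowerSeries.coeff (idx μ) Q = fourierCoeff f μ) →
      (∀ n, (∀ μ ∈ qIndexSet F, idx μ ≠ n) → MvPowerSeries.coeff n Q = 0) → enc f = Q := by
    intro f Q hQ hQ0
    ext n
    by_cases hn : ∃ μ ∈ qIndexSet F, idx μ = n
    · obtain ⟨μ, hμ, rfl⟩ := hn
      rw [(henc f).1 μ hμ, hQ μ hμ]
    · push Not at hn
      rw [(henc f).2 n hn, hQ0 n hn]
  have hol : ∀ {k : (F →+* ℝ) → ℤ} {f : Point F → ℂ}, f ∈ modularForms (Bianchi.Gamma1 𝔫) k → IsHolomorphicOn F f :=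
    fun hf ↦ hf.holomorphic
  have cont : ∀ {k : (F →+* ℝ) → ℤ} {f : Point F → ℂ}, f ∈ modularForms (Bianchi.Gamma1 𝔫) k → ContinuousOn f (halfSpace F) :=
    fun hf ↦ hf.holomorphic.continuousOn
  refine ⟨enc, henc, ?_, ?_, ?_, ?_, ?_⟩
  · -- multiplicativity
    intro k k' f g hf hg
    exact (hdict f g (hol hf) (hol hg) (stub_modularForm_periodic F 𝔫 k f hf) (stub_modularForm_periodic F 𝔫 k' g hg)
      (fun μ hμ hμc ↦ stub_modularForm_coeff_support F hd 𝔫 h𝔫 k f hf μ hμ hμc) (fun μ hμ hμc ↦ stub_modularForm_coeff_support F hd 𝔫 h𝔫 k' g hg μ hμ hμc)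
      (enc f) (enc g) (enc (f * g)) (henc f) (henc g) (henc (f * g)))
  · -- additivity
    intro k f g hf hg
    refine enc_ext (f + g) (enc f + enc g) (fun μ hμ ↦ ?_) (fun n hn ↦ ?_)
    · rw [map_add, (henc f).1 μ hμ, (henc g).1 μ hμ, fourierCoeff_eq, fourierCoeff_eq, fourierCoeff_eq]
      exact ((stub_fourierCoeff_linear F f g (cont hf) (cont hg) 1 μ (fun _ ↦ 1) fun _ ↦ one_pos).1).symm
    · rw [map_add, (henc f).2 n hn, (henc g).2 n hn, add_zero]
  · -- homogeneity
    intro k c f hf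
    refine enc_ext (c • f) (c • enc f) (fun μ hμ ↦ ?_) (fun n hn ↦ ?_)
    · rw [map_smul, (henc f).1 μ hμ, smul_eq_mul, fourierCoeff_eq, fourierCoeff_eq]
      exact ((stub_fourierCoeff_linear F f f (cont hf) (cont hf) c μ (fun _ ↦ 1) fun _ ↦ one_pos).2.1).symm
    · rw [map_smul, (henc f).2 n hn, smul_zero]
  · -- the unit form
    obtain ⟨hmem, h0, hne⟩ := stub_indicator_modularForm F (Bianchi.Gamma1 𝔫)
    refine ⟨hmem, enc_ext _ 1 (fun μ hμ ↦ ?_) (fun n hn ↦ ?_)⟩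
    · have hidx0 : idx 0 = 0 := by
        have h := hadd 0 zero_mem_qIndexSet 0 zero_mem_qIndexSet
        rw [add_zero] at h
        exact left_eq_add.1 h
      rw [MvPowerSeries.coeff_one]
      by_cases hμ0 : μ = 0
      · subst hμ0
        rw [if_pos hidx0, h0]
      · have : idx μ ≠ 0 := fun h ↦ hμ0 (hinj hμ zero_mem_qIndexSet (h.trans hidx0.symm))
        rw [if_neg this, hne μ hμ.1 hμ0]
    · rw [MvPowerSeries.coeff_one, if_neg]
      intro h0n
      have hidx0 : idx 0 = 0 := by
        have h := hadd 0 zero_mem_qIndexSet 0 zero_mem_qIndexSet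
        rw [add_zero] at h
        exact left_eq_add.1 h
      exact hn 0 zero_mem_qIndexSet (hidx0.trans h0n.symm)
  · -- injectivity
    intro k k' f g hf hg hfg
    have hcoef : ∀ μ : F, (∀ a : 𝓞 F, ∃ n : ℤ, Algebra.trace ℚ F (μ * a) = n) → fourierCoeff f μ = fourierCoeff g μ := by
      intro μ hμ
      by_cases hμc : μ ∈ qIndexSet F
      · rw [← (henc f).1 μ hμc, ← (henc g).1 μ hμc, hfg]
      · rw [stub_modularForm_coeff_support F hd 𝔫 h𝔫 k f hf μ hμ hμc, stub_modularForm_coeff_support F hd 𝔫 h𝔫 k' g hg μ hμ hμc]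
    have hℍ := stub_qExpansion_injective F f g (hol hf) (hol hg) (stub_modularForm_periodic F 𝔫 k f hf) (stub_modularForm_periodic F 𝔫 k' g hg) hcoef
    funext z
    by_cases hz : z ∈ halfSpace F
    · exact hℍ z hz
    · rw [hf.eq_zero z hz, hg.eq_zero z hz]

/-- **The graded family with the trace formula, from R1 and the landed §§ O–Q pieces** (real proof). -/
theorem traceEngineFamily (F : Type) [Field F] [NumberField F] [NumberField.IsTotallyReal F]
    (hd : 1 < Module.finrank ℚ F) (𝔫 : Ideal (𝓞 F)) (h𝔫 : 𝔫 ≠ ⊥) (E : Type) [Field E] [NumberField E] (τ : E →+* ℂ)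
    (p : ℕ) [Fact p.Prime] (v : E →+* PadicAlgCl p) :
    ∃ (d : ℕ) (idx : F → (Fin d →₀ ℕ)) (α : 𝓞 F) (enc : (Point F → ℂ) → MvPowerSeries (Fin d) ℂ)
    (V : ((F →+* ℝ) → ℤ) → Set (MvPowerSeries (Fin d) (PadicAlgCl p))),
    (∀ σ : F →+* ℝ, 0 < σ (α : F)) ∧ Set.InjOn idx (qIndexSet F) ∧
    (∀ μ ∈ qIndexSet F, ∀ μ' ∈ qIndexSet F, idx (μ + μ') = idx μ + idx μ') ∧
    (∀ ν ∈ qIndexSet F, ((∑ j, idx ν j : ℕ) : ℚ) = Algebra.trace ℚ F ((α : F) * ν)) ∧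
    (∀ f : Point F → ℂ, (∀ μ ∈ qIndexSet F, MvPowerSeries.coeff (idx μ) (enc f) = fourierCoeff f μ) ∧
        ∀ n, (∀ μ ∈ qIndexSet F, idx μ ≠ n) → MvPowerSeries.coeff n (enc f) = 0) ∧
    (∀ (k k' : (F →+* ℝ) → ℤ) (f g : Point F → ℂ), f ∈ modularForms (Bianchi.Gamma1 𝔫) k →
        g ∈ modularForms (Bianchi.Gamma1 𝔫) k' → enc f = enc g → f = g) ∧
    (∀ (k k' : (F →+* ℝ) → ℤ) (f g : Point F → ℂ), f ∈ modularForms (Bianchi.Gamma1 𝔫) k →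
        g ∈ modularForms (Bianchi.Gamma1 𝔫) k' → enc (f * g) = enc f * enc g) ∧
    (∀ (k : (F →+* ℝ) → ℤ) (f g : Point F → ℂ), f ∈ modularForms (Bianchi.Gamma1 𝔫) k →
        g ∈ modularForms (Bianchi.Gamma1 𝔫) k → enc (f + g) = enc f + enc g) ∧
    (∀ (k : (F →+* ℝ) → ℤ) (c : ℂ) (f : Point F → ℂ), f ∈ modularForms (Bianchi.Gamma1 𝔫) k →
        enc (c • f) = c • enc f) ∧
    ((halfSpace F).indicator (fun _ ↦ (1 : ℂ)) ∈ modularForms (Bianchi.Gamma1 𝔫) 0 ∧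
        enc ((halfSpace F).indicator (fun _ ↦ (1 : ℂ))) = 1) ∧
    (∀ b φ, φ ∈ V b ↔ φ ∈ (Submodule.span (PadicAlgCl p)
        {ψ | ∃ (A : MvPowerSeries (Fin d) E) (f : Point F → ℂ), f ∈ modularForms (Bianchi.Gamma1 𝔫) b ∧
          MvPowerSeries.map τ A = enc f ∧ ψ = MvPowerSeries.map v A} : Set (MvPowerSeries (Fin d) (PadicAlgCl p)))) ∧
    (1 : MvPowerSeries (Fin d) (PadicAlgCl p)) ∈ V 0 ∧ (∀ b, (0 : MvPowerSeries (Fin d) (PadicAlgCl p)) ∈ V b) ∧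
    (∀ b φ ψ, φ ∈ V b → ψ ∈ V b → φ + ψ ∈ V b) ∧ (∀ b (c : PadicAlgCl p) φ, φ ∈ V b → c • φ ∈ V b) ∧
    ∀ b₁ b₂ φ ψ, φ ∈ V b₁ → ψ ∈ V b₂ → φ * ψ ∈ V (b₁ + b₂) := by
  obtain ⟨d, idx, α, hα, hinj, hadd, htrace⟩ := stub_qIndex_encoding_trace F
  have hdict := eid_dict_of_idx F d idx hinj hadd
  obtain ⟨enc, henc, hmul, haddenc, hsmul, hone, hinjenc⟩ :=
    eid_qexpRing_of_dict F hd 𝔫 h𝔫 d idx hinj hadd hdict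
  set S : ((F →+* ℝ) → ℤ) → Set (MvPowerSeries (Fin d) (PadicAlgCl p)) := fun b ↦
    {ψ | ∃ (A : MvPowerSeries (Fin d) E) (f : Point F → ℂ), f ∈ modularForms (Bianchi.Gamma1 𝔫) b ∧
      MvPowerSeries.map τ A = enc f ∧ ψ = MvPowerSeries.map v A} with hSdef
  obtain ⟨h1S, hmulS⟩ := stub_rationalFamily_axioms F 𝔫 d enc hmul hone E τ p v
  have h1 : (1 : MvPowerSeries (Fin d) (PadicAlgCl p)) ∈ S 0 := by
    obtain ⟨A, f, hf, hA, h1⟩ := h1S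
    exact ⟨A, f, hf, hA, h1⟩
  have hmul' : ∀ b₁ b₂, ∀ x ∈ S b₁, ∀ y ∈ S b₂, x * y ∈ S (b₁ + b₂) := fun b₁ b₂ x hx y hy ↦ hmulS b₁ b₂ x y hx hy
  obtain ⟨hV1, hV0, hVadd, hVsmul, hVmul⟩ :=
    stub_gradedSpan_axioms (PadicAlgCl p) ((F →+* ℝ) → ℤ) (MvPowerSeries (Fin d) (PadicAlgCl p)) S h1 hmul'
  exact ⟨d, idx, α, enc, fun b ↦ (Submodule.span (PadicAlgCl p) (S b) : Set (MvPowerSeries (Fin d) (PadicAlgCl p))),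
    hα, hinj, hadd, htrace, henc, hinjenc, hmul, haddenc, hsmul, hone, fun b φ ↦ Iff.rfl, hV1, hV0, hVadd, hVsmul, hVmul⟩

/-- **`harch` for the unknown, from R2, R3 and the landed S17** (real proof). -/
theorem archFromTube (F : Type) [Field F] [NumberField F] [NumberField.IsTotallyReal F] (d : ℕ)
    (idx : F → (Fin d →₀ ℕ)) (α : F) (hα : ∀ σ : F →+* ℝ, 0 < σ α) (_hinj : Set.InjOn idx (qIndexSet F))
    (htrace : ∀ ν ∈ qIndexSet F, ((∑ j, idx ν j : ℕ) : ℚ) = Algebra.trace ℚ F (α * ν))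
    (E : Type) [Field E] [NumberField E] (c : F → E)
    (habs : ∀ (τ : E →+* ℂ) (y : (F →+* ℝ) → ℝ), (∀ σ, 0 < y σ) →
      Summable (fun ν : {ν : F | ∀ b : 𝓞 F, ∃ n : ℤ, Algebra.trace ℚ F (ν * b) = n} ↦
        ‖τ (c ν)‖ * Real.exp (-(2 * Real.pi * ∑ σ : F →+* ℝ, σ (ν : F) * y σ))))
    (G : MvPowerSeries (Fin d) E) (hG : ∀ ν ∈ qIndexSet F, MvPowerSeries.coeff (idx ν) G = c ν)
    (hG0 : ∀ n, (∀ ν ∈ qIndexSet F, idx ν ≠ n) → MvPowerSeries.coeff n G = 0) (η : ℝ) (hη : 0 < η) :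
    ∃ B : ℝ, 1 ≤ B ∧ ∀ τ : E →+* ℂ,
      Summable (fun n : Fin d →₀ ℕ ↦ ‖τ (MvPowerSeries.coeff n G)‖ * Real.exp (-η) ^ (∑ j, n j)) ∧
      ∑' n : Fin d →₀ ℕ, ‖τ (MvPowerSeries.coeff n G)‖ * Real.exp (-η) ^ (∑ j, n j) ≤ B := by
  classical
  -- weight and level sets
  set wt : (Fin d →₀ ℕ) → ℕ := fun n ↦ ∑ j, n j with hwtdef
  have hlevel : ∀ m : ℕ, {n : Fin d →₀ ℕ | wt n = m}.Finite ∧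
      (({n : Fin d →₀ ℕ | wt n = m}.ncard : ℕ) : ℝ) ≤ 1 * ((m : ℝ) + 1) ^ d := fun m ↦ by
    simpa [hwtdef] using stub_totalDegree_levelCount d m
  -- the weight of an encoded cone index
  set w : F → ℕ := fun ν ↦ ∑ j, idx ν j with hwdef
  have hw : ∀ ν ∈ qIndexSet F, (w ν : ℝ) = ((Algebra.trace ℚ F (α * ν) : ℚ) : ℝ) := fun ν hν ↦ by
    rw [← htrace ν hν]; push_cast [hwdef]; rfl
  -- radius-type bounds for every embedding
  have hbound : ∀ τ : E →+* ℂ, ∀ s : ℝ, 0 < s → s < 1 → ∃ C : ℝ, ∀ n : Fin d →₀ ℕ,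
      ‖τ (MvPowerSeries.coeff n G)‖ * s ^ wt n ≤ C := by
    intro τ s hs0 hs1
    obtain ⟨C, hC⟩ := stub_coeff_radius_from_tube F α hα (fun ν ↦ τ (c ν)) (habs τ) w hw s hs0 hs1
    refine ⟨max C 0, fun n ↦ ?_⟩
    by_cases hn : ∃ ν ∈ qIndexSet F, idx ν = n
    · obtain ⟨ν, hν, rfl⟩ := hn
      rw [hG ν hν]
      exact (hC ν hν).trans (le_max_left _ _)
    · push Not at hn
      rw [hG0 n hn, map_zero, norm_zero, zero_mul]
      exact le_max_right _ _
  -- summability for every embedding (S17)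
  have hsum : ∀ τ : E →+* ℂ, Summable (fun n : Fin d →₀ ℕ ↦ ‖τ (MvPowerSeries.coeff n G)‖ * Real.exp (-η) ^ wt n) :=
    fun τ ↦ stub_summable_of_levelGrowth wt d 1 hlevel (fun n ↦ τ (MvPowerSeries.coeff n G)) (hbound τ)
      (Real.exp (-η)) (Real.exp_nonneg _) (Real.exp_lt_one_iff.2 (by linarith))
  -- a uniform bound over the finitely many embeddings
  refine ⟨1 + ∑ τ : E →+* ℂ, ∑' n : Fin d →₀ ℕ, ‖τ (MvPowerSeries.coeff n G)‖ * Real.exp (-η) ^ wt n, ?_, fun τ ↦ ⟨hsum τ, ?_⟩⟩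
  · have : 0 ≤ ∑ τ : E →+* ℂ, ∑' n : Fin d →₀ ℕ, ‖τ (MvPowerSeries.coeff n G)‖ * Real.exp (-η) ^ wt n :=
      Finset.sum_nonneg fun τ _ ↦ tsum_nonneg fun n ↦ mul_nonneg (norm_nonneg _) (pow_nonneg (Real.exp_nonneg _) _)
    linarith
  · have hle : ∑' n : Fin d →₀ ℕ, ‖τ (MvPowerSeries.coeff n G)‖ * Real.exp (-η) ^ wt n ≤
        ∑ τ' : E →+* ℂ, ∑' n : Fin d →₀ ℕ, ‖τ' (MvPowerSeries.coeff n G)‖ * Real.exp (-η) ^ wt n :=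
      Finset.single_le_sum (f := fun τ' : E →+* ℂ ↦ ∑' n : Fin d →₀ ℕ, ‖τ' (MvPowerSeries.coeff n G)‖ * Real.exp (-η) ^ wt n)
        (fun τ' _ ↦ tsum_nonneg fun n ↦ mul_nonneg (norm_nonneg _) (pow_nonneg (Real.exp_nonneg _) _)) (Finset.mem_univ τ)
    linarith

end Summit.Langlands.Langlands.Theorems.HilbertIntegralOverconvergentIsCongruence
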